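import Summits.NavierStokesRegularity.FluidComputer.AngularGalerkinLadderAdjoint
import Summits.NavierStokesRegularity.FluidComputer.AngularGalerkinLadderBasics
import Summits.NavierStokesRegularity.FluidComputer.AngularGalerkinLadderRotation
import HarnessLib

/-!
# The pressure gauge of a rung profile: the ungated defect-decay stub is false (route
`AngularGalerkinLadder`, K2 `NoOverheating`)

Negative-lane kernel fact for `stmt-NavierStokesRegularity-19960` (`NoOverheating`, crux K2 of route
№8 `AngularGalerkinLadder`), cell ns-blowup, refuter5 (K5-45), filed at the planner's request
(plan g21).  No route file is imported; nothing here asserts a Theses declaration.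

The first birth skeleton of K2 (`Cruxes/NoOverheating/Lines/birth.lean`, v3) split the crux through
the stub

  `stub_defect_decay : ∀ C₀ c_min c_max, ∃ ε → 0, ∀ L c R u p d,`
  `   IsRungProfile L C₀ c R u p d → c_min ≤ c → c ≤ c_max → HasDefectBound (ε L) d`

("high rungs have uniformly small Galerkin defect").  As written it quantifies over the defect `d`
of `IsRungSolutionOn`, which is only determined UP TO THE PRESSURE GAUGE `(p, d) ↦ (p + q, d + ∇q)`:
the momentum equation sees `−∇p + d` only, and at rung `0` every constant field is an admissible
(co-band-limited) force.  Hence the rest state `u ≡ 0` with the linear pressure `p(x) = x₂` and the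
constant defect `d ≡ e₂` is a Type-I rotated-DSS ancient rung-`0` profile for every factor `c > 1`,
while a non-zero constant never satisfies the scale-invariant envelope `‖d(t,x)‖ ≤ η/(‖x‖+√−t)³`.

* `isCobandLimited_zero_const_cross` — every constant field `e_a × c` is co-band-limited of degree
  `0`: by the adjointness `∫⟪J_a v, ψ⟫ = −∫⟪v, J_a ψ⟫` (`integral_inner_angGen_eq_neg`) and the
  vanishing of all generators on compactly supported degree-`0` test fields
  (`angGen_eq_zero_of_isBandLimited_zero`), since `J_a` of a constant `c` is the constant `e_a × c`.
* `isRungProfile_restGauge` — `(u, p, d) = (0, x ↦ x₂, e₂)` is an `IsRungProfile 0 0 c R` for every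
  `c > 1` and every isometry `R`.
* `not_hasDefectBound_const` — a non-zero constant force violates `HasDefectBound η` for every `η`.
* `stub_defect_decay_false` — the v3 stub is false (instance `C₀ = 0`, `c_min = c_max = 2`, `L = 0`).

READING (refuter, information — not a verdict on any item): this does NOT touch `NoOverheating`
itself (there the defect bound sits in the CONCLUSION `∃ … IsWindowProfile …`, where the prover picks
the gauge), nor the v4 stub `stub_defect_decay_physical`, which adds the physical gauge
`div d(t) = 0 ∧ HasDefectBound M d` — the constant gauge is excluded there by the envelope, and a
gradient gauge `∇q` with `q` harmonic and `∇q = O(‖x‖⁻³)` is zero.  Any re-split of K2 that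
quantifies over `d` universally must carry such a gauge condition.
-/

namespace Summit.NavierStokesRegularity.NoOverheatingDefectGauge

open Set MeasureTheory Filter Topology Function
open scoped ContDiff RealInnerProductSpace
open Literature.Analysis.FluidPDE
open Summit.NavierStokesRegularity.FluidComputer
open Summit.NavierStokesRegularity.FluidComputer.AngularLadder

/-! ## §1 Constant forces are admissible rung-`0` defects -/

/-- The generator `J_a` of a constant field `c` is the constant field `e_a × c` (the transport term
vanishes). [folklore] -/
theorem angGen_const (a : Fin 3) (c x : EuclideanSpace ℝ (Fin 3)) :
    angGen a (fun _ => c) x = cross (axis a) c := by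
  simp [angGen]

/-- **Every constant field of the form `e_a × c` is co-band-limited of degree `0`**: it is
`L²`-orthogonal to all compactly supported smooth fields with `𝒞ψ = 0`. [folklore] -/
theorem isCobandLimited_zero_const_cross (a : Fin 3) (c : EuclideanSpace ℝ (Fin 3)) :
    IsCobandLimited 0 (fun _ => cross (axis a) c) := by
  intro ψ hψ hψc
  have h := integral_inner_angGen_eq_neg (v := fun _ => c) contDiff_const hψ.1 hψc a
  have hz : angGen a ψ = 0 := angGen_eq_zero_of_isBandLimited_zero hψ hψc a
  simpa [angGen_const, hz] using h

/-- `e₀ × e₁ = e₂`. [folklore] -/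
theorem cross_axis_zero_one : cross (axis 0) (axis 1) = axis 2 := by
  apply PiLp.ext
  intro j
  fin_cases j <;> simp [cross, cross_apply, axis_apply]

/-- The constant field `e₂` is co-band-limited of degree `0`. [folklore] -/
theorem isCobandLimited_zero_const_axis_two : IsCobandLimited 0 (fun _ => axis 2) := by
  simpa [cross_axis_zero_one] using isCobandLimited_zero_const_cross 0 (axis 1)

/-! ## §2 The rest state in the constant gauge is a rung-`0` profile -/

/-- `∇⟪e, ·⟫ = e`. [folklore] -/
theorem gradient_inner_const (e x : EuclideanSpace ℝ (Fin 3)) :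
    gradient (fun y : EuclideanSpace ℝ (Fin 3) => ⟪e, y⟫) x = e := by
  have hf : HasFDerivAt (fun y : EuclideanSpace ℝ (Fin 3) => ⟪e, y⟫) (innerSL ℝ e) x :=
    (innerSL ℝ e).hasFDerivAt
  ext i
  have hi : (gradient (fun y : EuclideanSpace ℝ (Fin 3) => ⟪e, y⟫) x) i =
      ⟪gradient (fun y : EuclideanSpace ℝ (Fin 3) => ⟪e, y⟫) x, EuclideanSpace.single i (1 : ℝ)⟫ := by
    rw [EuclideanSpace.inner_single_right]; simp
  rw [hi, inner_gradient_left, hf.fderiv, innerSL_apply_apply, EuclideanSpace.inner_single_right]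
  simp

/-- **The rest state with the linear pressure `x₂` and the constant force `e₂` is a classical
solution** of the forced Navier–Stokes system on any time set, for any viscosity
(`0 + 0 = 0 − e₂ + e₂`). [folklore] -/
theorem isClassicalNSSolutionOn_restGauge (S : Set ℝ) (ν : ℝ) :
    IsClassicalNSSolutionOn S ν (fun _ _ => axis 2 : ℝ → EuclideanSpace ℝ (Fin 3) → EuclideanSpace ℝ (Fin 3))
      (0 : ℝ → EuclideanSpace ℝ (Fin 3) → EuclideanSpace ℝ (Fin 3)) (fun _ x => ⟪axis 2, x⟫ : ℝ → EuclideanSpace ℝ (Fin 3) → ℝ) where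
  smooth_velocity := contDiffOn_const
  smooth_pressure := by
    have : ContDiff ℝ ∞ (uncurry (fun _ x => ⟪axis 2, x⟫ : ℝ → EuclideanSpace ℝ (Fin 3) → ℝ)) := by
      change ContDiff ℝ ∞ fun q : ℝ × EuclideanSpace ℝ (Fin 3) => ⟪axis 2, q.2⟫
      exact (innerSL ℝ (axis 2)).contDiff.comp contDiff_snd
    exact this.contDiffOn
  momentum t _ x := by
    simp [convect, Pi.zero_def, gradient_inner_const]
  divFree t _ := by
    simp only [VectorCalculus.IsDivFree, VectorCalculus.divergence]
    intro x
    simp [Pi.zero_def]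

/-- **The rest state in the constant gauge is a Type-I rotated-DSS ancient rung-`0` profile** with
Type-I constant `0`, for every DSS factor `c > 1` and every rotation `R`. [folklore] -/
theorem isRungProfile_restGauge {c : ℝ} (hc : 1 < c)
    (R : EuclideanSpace ℝ (Fin 3) ≃ₗᵢ[ℝ] EuclideanSpace ℝ (Fin 3)) :
    IsRungProfile 0 0 c R (0 : ℝ → EuclideanSpace ℝ (Fin 3) → EuclideanSpace ℝ (Fin 3))
      (fun _ x => ⟪axis 2, x⟫) (fun _ _ => axis 2) := by
  refine ⟨⟨isClassicalNSSolutionOn_restGauge _ _, fun t _ => isBandLimited_zero_field 0,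
    fun t _ => isCobandLimited_zero_const_axis_two⟩, hc, ?_, ?_⟩
  · intro t x
    simp
  · intro t _ x
    simp

/-! ## §3 A non-zero constant force has no scale-invariant envelope -/

/-- **A non-zero constant force violates `HasDefectBound η` for every `η`**: at `t = −1` the envelope
`‖e‖ ≤ η/(‖x‖+1)³` fails at the point `x = (η/‖e‖²)•e` of norm `η/‖e‖`. [folklore] -/
theorem not_hasDefectBound_const {e : EuclideanSpace ℝ (Fin 3)} (he : e ≠ 0) (η : ℝ) :
    ¬ HasDefectBound η (fun _ _ => e) := by
  intro h
  have hn : 0 < ‖e‖ := norm_pos_iff.2 he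
  have h0 := h (-1) (by norm_num) 0
  simp only [norm_zero, neg_neg, Real.sqrt_one, zero_add, one_pow, div_one] at h0
  -- `h0 : ‖e‖ ≤ η`, so `η > 0`
  have hη : 0 < η := hn.trans_le h0
  set s : ℝ := η / ‖e‖ with hs_def
  have hs : 0 ≤ s := div_nonneg hη.le hn.le
  have hse : ‖e‖ * s = η := by rw [hs_def]; field_simp
  have h1 := h (-1) (by norm_num) ((s / ‖e‖) • e)
  have hx : ‖(s / ‖e‖) • e‖ = s := by
    rw [norm_smul, Real.norm_of_nonneg (div_nonneg hs hn.le), div_mul_cancel₀ s hn.ne']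
  simp only [hx, neg_neg, Real.sqrt_one] at h1
  -- `h1 : ‖e‖ ≤ η / (s + 1) ^ 3` with `‖e‖ s = η`
  rw [le_div_iff₀ (by positivity)] at h1
  have h3 : s + 1 ≤ (s + 1) ^ 3 := le_self_pow₀ (by linarith) (by norm_num)
  have h4 : ‖e‖ * (s + 1) ≤ ‖e‖ * (s + 1) ^ 3 := mul_le_mul_of_nonneg_left h3 hn.le
  nlinarith

/-- `e₂ ≠ 0`. [folklore] -/
theorem axis_two_ne_zero : axis 2 ≠ (0 : EuclideanSpace ℝ (Fin 3)) := by
  intro h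
  have := congrArg (fun v : EuclideanSpace ℝ (Fin 3) => v 2) h
  simp [axis_apply] at this

/-- The constant gauge force `e₂` has no scale-invariant envelope. [folklore] -/
theorem not_hasDefectBound_axis_two (η : ℝ) : ¬ HasDefectBound η (fun _ _ => axis 2) :=
  not_hasDefectBound_const axis_two_ne_zero η

/-! ## §4 The ungated stub is false -/

/-- **The ungated defect-decay stub of the first K2 skeleton is false**
(`stub_defect_decay` of `Cruxes/NoOverheating/Lines/birth.lean` v3): instantiate `C₀ = 0`,
`c_min = c_max = 2`, `L = 0` and the rest state in the constant gauge `(0, x₂, e₂)`; the concluded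
`HasDefectBound (ε 0) e₂` fails for every value `ε 0`.  The decay `ε → 0` is not even used: the
statement is false rung by rung.  Any universally-quantified defect-decay stub must fix the gauge
(e.g. `div d(t) = 0` plus an envelope, as in skeleton v4). [folklore] -/
theorem stub_defect_decay_false :
    ¬ (∀ C₀ cmin cmax : ℝ, ∃ ε : ℕ → ℝ, Tendsto ε atTop (𝓝 0) ∧
      ∀ (L : ℕ) (c : ℝ) (R : EuclideanSpace ℝ (Fin 3) ≃ₗᵢ[ℝ] EuclideanSpace ℝ (Fin 3))
        (u : ℝ → EuclideanSpace ℝ (Fin 3) → EuclideanSpace ℝ (Fin 3))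
        (p : ℝ → EuclideanSpace ℝ (Fin 3) → ℝ)
        (d : ℝ → EuclideanSpace ℝ (Fin 3) → EuclideanSpace ℝ (Fin 3)),
        IsRungProfile L C₀ c R u p d → cmin ≤ c → c ≤ cmax → HasDefectBound (ε L) d) := by
  intro h
  obtain ⟨ε, -, hε⟩ := h 0 2 2
  exact not_hasDefectBound_axis_two (ε 0)
    (hε 0 2 (LinearIsometryEquiv.refl ℝ _) 0 (fun _ x => ⟪axis 2, x⟫) (fun _ _ => axis 2)
      (isRungProfile_restGauge (by norm_num) _) le_rfl le_rfl)

/-- The same without the (irrelevant) decay clause: **at rung `0` no uniform defect bound holds over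
all profiles of a window**, for any window `C₀ ≥ 0`, `1 < c_max`, `c_min ≤ c_max`. [folklore] -/
theorem no_uniform_defectBound_rung_zero {C₀ cmin cmax : ℝ} (hC : 0 ≤ C₀) (hmax : 1 < cmax)
    (hmm : cmin ≤ cmax) (η : ℝ) :
    ¬ (∀ (c : ℝ) (R : EuclideanSpace ℝ (Fin 3) ≃ₗᵢ[ℝ] EuclideanSpace ℝ (Fin 3))
        (u : ℝ → EuclideanSpace ℝ (Fin 3) → EuclideanSpace ℝ (Fin 3))
        (p : ℝ → EuclideanSpace ℝ (Fin 3) → ℝ)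
        (d : ℝ → EuclideanSpace ℝ (Fin 3) → EuclideanSpace ℝ (Fin 3)),
        IsRungProfile 0 C₀ c R u p d → cmin ≤ c → c ≤ cmax → HasDefectBound η d) := by
  intro h
  have hP : IsRungProfile 0 C₀ cmax (LinearIsometryEquiv.refl ℝ _)
      (0 : ℝ → EuclideanSpace ℝ (Fin 3) → EuclideanSpace ℝ (Fin 3))
      (fun _ x => ⟪axis 2, x⟫) (fun _ _ => axis 2) := by
    obtain ⟨hsol, _, hdss, _⟩ := isRungProfile_restGauge hmax (LinearIsometryEquiv.refl ℝ _)
    refine ⟨hsol, hmax, hdss, ?_⟩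
    intro t ht x
    simp only [Pi.zero_apply, norm_zero]
    positivity
  exact not_hasDefectBound_axis_two η (h cmax _ 0 _ _ hP hmm le_rfl)

end Summit.NavierStokesRegularity.NoOverheatingDefectGauge
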